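import Mathlib
import Summits.Ventures.PercRepro2.Defs

/-!
# Functionals of the trace read through a `Finset` (blind cell PercRepro2, night-2 g3;
proofs/NIGHT2-DARC.md §17)

`trace_bhk` wants functionals `Set V → R`; the trace data of a pendant set live on
`P.powerset`.  `traceFn P f S = f (P.filter (· ∈ S))` extends `f : Finset V → R` to all sets;
on a trace `↑Z` (`Z ⊆ P`) it is `f Z` (`traceFn_coe`), it is monotone when `f` is monotone on the
subsets of `P` (`monotone_traceFn`) and nonnegative when `f` is (`traceFn_nonneg`).
-/

namespace Summit.Ventures.PercRepro2.Coin

section TraceFn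

open Classical

variable {V : Type*} {R : Type*}

/-- The functional of the trace induced by `f : Finset V → R`: `S ↦ f (P ∩ S)`. -/
noncomputable def traceFn (P : Finset V) (f : Finset V → R) (S : Set V) : R :=
  f (P.filter (· ∈ S))

/-- On a trace `↑Z`, `Z ⊆ P`, the functional is `f Z`. -/
lemma traceFn_coe (P : Finset V) (f : Finset V → R) {Z : Finset V} (hZ : Z ⊆ P) :
    traceFn P f (↑Z : Set V) = f Z := by
  unfold traceFn
  congr 1
  ext z
  simp only [Finset.mem_filter, Finset.mem_coe]
  exact ⟨fun h => h.2, fun h => ⟨hZ h, h⟩⟩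

/-- `traceFn P f` is monotone when `f` is monotone on the subsets of `P`. -/
lemma monotone_traceFn [Preorder R] (P : Finset V) {f : Finset V → R}
    (hf : ∀ Z Z' : Finset V, Z ⊆ Z' → Z' ⊆ P → f Z ≤ f Z') : Monotone (traceFn P f) := by
  intro S S' hSS'
  unfold traceFn
  refine hf _ _ ?_ (Finset.filter_subset _ _)
  intro z hz
  rw [Finset.mem_filter] at hz ⊢
  exact ⟨hz.1, hSS' hz.2⟩

/-- `traceFn P f` is nonnegative when `f` is nonnegative on the subsets of `P`. -/
lemma traceFn_nonneg [Zero R] [Preorder R] (P : Finset V) {f : Finset V → R}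
    (hf : ∀ Z : Finset V, Z ⊆ P → 0 ≤ f Z) (S : Set V) : 0 ≤ traceFn P f S :=
  hf _ (Finset.filter_subset _ _)

end TraceFn

end Summit.Ventures.PercRepro2.Coin
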